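import Summits.Ventures.PercRepro.C025ProfileTwoFlatRows
import Summits.Ventures.PercRepro.C025ProfileOneFlatAllTau
import Summits.Ventures.PercRepro.C025ProfileSecondRowDirectSumLemmas
import Summits.Ventures.PercRepro.MatroidTruncate

/-!
# THE TWO-FLAT MODEL `T_r(U_{s₁,F₁} ⊕ U_{s₂,F₂} ⊕ U_{m,m})` AND C-025 ON IT, MODULO THE ARITHMETIC CORE (night-3 g26)

`proofs/NIGHT3-G26-TWOFLATS.md` §5.  The two-flat model is typer-2's truncation of the disjoint sum of two copies of
night-1's `modelMatroid` taken untruncated (`modelMatroid hE F s (s + #(E ∖ F)) = U_{s,F} ⊕ U_{E∖F,E∖F}`), on disjoint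
finite ground sets `E₁`, `E₂` with fat flats `F₁ ⊆ E₁`, `F₂ ⊆ E₂`; its free part is `(E₁ ∖ F₁) ∪ (E₂ ∖ F₂)`.  Its rank
function is `min(r, min(|X∩F₁|, s₁) + min(|X∩F₂|, s₂) + |X ∩ free|)` (`twoFlatModel_eRk_finset`), so the split-form
theorem `profileIneq_rows_twoFlat_of_arith` applies: every row `(q, u)`, `q < u < r`, of (Π) on the model follows from
the two-flat arithmetic core (TF) at `(#F₁, s₁, #F₂, s₂, #free, q, u)` (`profileIneq_rows_twoFlatModel_of_arith`), and
through `GirthRows.rls_of_profileIneq_rows` **C-025 at every `(p, q)` with `p ≤ r`** follows from (TF) at the rows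
`q < u < p` (`rls_twoFlatModel_of_arith`).  (TF) is the only open obligation.  No `def`, no `instance`, no notation.
Axioms: standard.
-/

open scoped Matroid

namespace PercRepro

open Finset ThmH

namespace TwoFlat

variable {α : Type} [DecidableEq α]

section Model

variable {E₁ E₂ : Set α} (hE₁ : E₁.Finite) (hE₂ : E₂.Finite) (F₁ F₂ : Set α) (s₁ s₂ : ℕ)

omit [DecidableEq α] in
/-- The disjoint sum of the two untruncated one-flat models is finite (a theorem, not an instance). -/
theorem disjointSum_models_finite
    (h : Disjoint (modelMatroid hE₁ F₁ s₁ (s₁ + (E₁ \ F₁).ncard)).E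
      (modelMatroid hE₂ F₂ s₂ (s₂ + (E₂ \ F₂).ncard)).E) :
    ((modelMatroid hE₁ F₁ s₁ (s₁ + (E₁ \ F₁).ncard)).disjointSum
      (modelMatroid hE₂ F₂ s₂ (s₂ + (E₂ \ F₂).ncard)) h).Finite :=
  ⟨by rw [Matroid.disjointSum_ground_eq, modelMatroid_E, modelMatroid_E]; exact hE₁.union hE₂⟩

omit [DecidableEq α] in
/-- The rank of `X ⊆ E` in the untruncated one-flat model: `min(|X ∩ F|, s) + |X ∖ F|`. -/
theorem modelMatroid_untrunc_eRk {E : Set α} (hE : E.Finite) (F : Set α) (s : ℕ) {X : Set α} (hX : X ⊆ E) :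
    (modelMatroid hE F s (s + (E \ F).ncard)).eRk X = ((min (X ∩ F).ncard s + (X \ F).ncard : ℕ) : ℕ∞) := by
  rw [modelMatroid_eRk hE F (by omega) hX]
  congr 1
  apply min_eq_left
  have : (X \ F).ncard ≤ (E \ F).ncard :=
    Set.ncard_le_ncard (Set.sdiff_subset_sdiff_left hX) (Set.Finite.sdiff hE)
  omega

variable (h : Disjoint (modelMatroid hE₁ F₁ s₁ (s₁ + (E₁ \ F₁).ncard)).E
  (modelMatroid hE₂ F₂ s₂ (s₂ + (E₂ \ F₂).ncard)).E) (r : ℕ)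

omit [DecidableEq α] in
/-- The ground set of the two-flat model is `E₁ ∪ E₂`. -/
theorem twoFlatModel_gr :
    haveI := disjointSum_models_finite hE₁ hE₂ F₁ F₂ s₁ s₂ h
    ((gr (Matroid.truncate ((modelMatroid hE₁ F₁ s₁ (s₁ + (E₁ \ F₁).ncard)).disjointSum
      (modelMatroid hE₂ F₂ s₂ (s₂ + (E₂ \ F₂).ncard)) h) r) : Finset α) : Set α) = E₁ ∪ E₂ := by
  haveI := disjointSum_models_finite hE₁ hE₂ F₁ F₂ s₁ s₂ h
  rw [coe_gr, Matroid.truncate_ground, Matroid.disjointSum_ground_eq, modelMatroid_E, modelMatroid_E]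

omit [DecidableEq α] in
/-- The rank function of the two-flat model on any set `X`:
`min(r, min(|X∩F₁|, s₁) + |X ∩ (E₁∖F₁)| + min(|X∩F₂|, s₂) + |X ∩ (E₂∖F₂)|)`. -/
theorem twoFlatModel_eRk (hF₁ : F₁ ⊆ E₁) (hF₂ : F₂ ⊆ E₂) (X : Set α) :
    haveI := disjointSum_models_finite hE₁ hE₂ F₁ F₂ s₁ s₂ h
    (Matroid.truncate ((modelMatroid hE₁ F₁ s₁ (s₁ + (E₁ \ F₁).ncard)).disjointSum
      (modelMatroid hE₂ F₂ s₂ (s₂ + (E₂ \ F₂).ncard)) h) r).eRk X =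
      ((min r (min (X ∩ F₁).ncard s₁ + (X ∩ (E₁ \ F₁)).ncard +
        (min (X ∩ F₂).ncard s₂ + (X ∩ (E₂ \ F₂)).ncard)) : ℕ) : ℕ∞) := by
  haveI := disjointSum_models_finite hE₁ hE₂ F₁ F₂ s₁ s₂ h
  rw [Matroid.truncate_eRk, SecondRow.eRk_disjointSum, modelMatroid_E, modelMatroid_E,
    modelMatroid_untrunc_eRk hE₁ F₁ s₁ Set.inter_subset_right,
    modelMatroid_untrunc_eRk hE₂ F₂ s₂ Set.inter_subset_right]
  have e1 : X ∩ E₁ ∩ F₁ = X ∩ F₁ := by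
    ext x; simp only [Set.mem_inter_iff]
    exact ⟨fun hx => ⟨hx.1.1, hx.2⟩, fun hx => ⟨⟨hx.1, hF₁ hx.2⟩, hx.2⟩⟩
  have e2 : (X ∩ E₁) \ F₁ = X ∩ (E₁ \ F₁) := by
    ext x; simp only [Set.mem_inter_iff, Set.mem_sdiff]
    tauto
  have e3 : X ∩ E₂ ∩ F₂ = X ∩ F₂ := by
    ext x; simp only [Set.mem_inter_iff]
    exact ⟨fun hx => ⟨hx.1.1, hx.2⟩, fun hx => ⟨⟨hx.1, hF₂ hx.2⟩, hx.2⟩⟩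
  have e4 : (X ∩ E₂) \ F₂ = X ∩ (E₂ \ F₂) := by
    ext x; simp only [Set.mem_inter_iff, Set.mem_sdiff]
    tauto
  rw [e1, e2, e3, e4, min_comm]
  set a := min (X ∩ F₁).ncard s₁ + (X ∩ (E₁ \ F₁)).ncard + (min (X ∩ F₂).ncard s₂ + (X ∩ (E₂ \ F₂)).ncard)
    with ha
  rcases le_total r a with hle | hle
  · rw [min_eq_left hle, min_eq_left (by exact_mod_cast hle)]
  · rw [min_eq_right hle, min_eq_right (by exact_mod_cast hle)]
    push_cast
    rfl

omit [DecidableEq α] in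
include hE₁ hE₂ in
/-- The two free parts together: `|X ∩ (E₁∖F₁)| + |X ∩ (E₂∖F₂)| = |X ∩ ((E₁ ∪ E₂) ∖ (F₁ ∪ F₂))|` (`E₁`, `E₂` disjoint). -/
theorem ncard_free_parts (hdisj : Disjoint E₁ E₂) (hF₁ : F₁ ⊆ E₁) (hF₂ : F₂ ⊆ E₂) (X : Set α) :
    (X ∩ (E₁ \ F₁)).ncard + (X ∩ (E₂ \ F₂)).ncard = (X ∩ ((E₁ ∪ E₂) \ (F₁ ∪ F₂))).ncard := by
  have hunion : X ∩ ((E₁ ∪ E₂) \ (F₁ ∪ F₂)) = (X ∩ (E₁ \ F₁)) ∪ (X ∩ (E₂ \ F₂)) := by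
    ext x
    simp only [Set.mem_inter_iff, Set.mem_sdiff, Set.mem_union]
    constructor
    · rintro ⟨hx, h12, hF⟩
      rcases h12 with h1 | h2
      · exact Or.inl ⟨hx, h1, fun h => hF (Or.inl h)⟩
      · exact Or.inr ⟨hx, h2, fun h => hF (Or.inr h)⟩
    · rintro (⟨hx, h1, hn⟩ | ⟨hx, h2, hn⟩)
      · refine ⟨hx, Or.inl h1, ?_⟩
        rintro (h | h)
        · exact hn h
        · exact Set.disjoint_left.1 hdisj h1 (hF₂ h)
      · refine ⟨hx, Or.inr h2, ?_⟩
        rintro (h | h)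
        · exact Set.disjoint_left.1 hdisj (hF₁ h) h2
        · exact hn h
  have hd : Disjoint (X ∩ (E₁ \ F₁)) (X ∩ (E₂ \ F₂)) := by
    apply Set.disjoint_left.2
    rintro x ⟨-, hx1, -⟩ ⟨-, hx2, -⟩
    exact Set.disjoint_left.1 hdisj hx1 hx2
  rw [hunion, Set.ncard_union_eq hd ((hE₁.sdiff).subset Set.inter_subset_right)
    ((hE₂.sdiff).subset Set.inter_subset_right)]

open Classical in
/-- The rank function of the two-flat model in the `Finset` vocabulary, for the split
`E₁' = {x ∈ gr M | x ∈ F₁}`, `E₂' = {x ∈ gr M | x ∈ F₂}`, `E₃' = {x ∈ gr M | x ∉ F₁ ∧ x ∉ F₂}`. -/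
theorem twoFlatModel_eRk_finset (hF₁ : F₁ ⊆ E₁) (hF₂ : F₂ ⊆ E₂) (X : Finset α) :
    haveI := disjointSum_models_finite hE₁ hE₂ F₁ F₂ s₁ s₂ h
    X ⊆ gr (Matroid.truncate ((modelMatroid hE₁ F₁ s₁ (s₁ + (E₁ \ F₁).ncard)).disjointSum
      (modelMatroid hE₂ F₂ s₂ (s₂ + (E₂ \ F₂).ncard)) h) r) →
    (Matroid.truncate ((modelMatroid hE₁ F₁ s₁ (s₁ + (E₁ \ F₁).ncard)).disjointSum
      (modelMatroid hE₂ F₂ s₂ (s₂ + (E₂ \ F₂).ncard)) h) r).eRk (X : Set α) =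
      ((min r (min (X ∩ (gr (Matroid.truncate ((modelMatroid hE₁ F₁ s₁ (s₁ + (E₁ \ F₁).ncard)).disjointSum
            (modelMatroid hE₂ F₂ s₂ (s₂ + (E₂ \ F₂).ncard)) h) r)).filter (fun x => x ∈ F₁)).card s₁ +
          min (X ∩ (gr (Matroid.truncate ((modelMatroid hE₁ F₁ s₁ (s₁ + (E₁ \ F₁).ncard)).disjointSum
            (modelMatroid hE₂ F₂ s₂ (s₂ + (E₂ \ F₂).ncard)) h) r)).filter (fun x => x ∈ F₂)).card s₂ +
          (X ∩ (gr (Matroid.truncate ((modelMatroid hE₁ F₁ s₁ (s₁ + (E₁ \ F₁).ncard)).disjointSum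
            (modelMatroid hE₂ F₂ s₂ (s₂ + (E₂ \ F₂).ncard)) h) r)).filter (fun x => x ∉ F₁ ∧ x ∉ F₂)).card) :
        ℕ) : ℕ∞) := by
  haveI := disjointSum_models_finite hE₁ hE₂ F₁ F₂ s₁ s₂ h
  intro hX
  have hdisj : Disjoint E₁ E₂ := by
    have := h
    rw [modelMatroid_E, modelMatroid_E] at this
    exact this
  set M := Matroid.truncate ((modelMatroid hE₁ F₁ s₁ (s₁ + (E₁ \ F₁).ncard)).disjointSum
    (modelMatroid hE₂ F₂ s₂ (s₂ + (E₂ \ F₂).ncard)) h) r with hM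
  have hgr : ((gr M : Finset α) : Set α) = E₁ ∪ E₂ := twoFlatModel_gr hE₁ hE₂ F₁ F₂ s₁ s₂ h r
  have hXE : (X : Set α) ⊆ E₁ ∪ E₂ := by rw [← hgr]; exact_mod_cast hX
  have c1 : (((X ∩ (gr M).filter (fun x => x ∈ F₁)) : Finset α) : Set α) = (X : Set α) ∩ F₁ := by
    ext x
    simp only [coe_inter, coe_filter, Set.mem_inter_iff, Set.mem_setOf_eq, mem_coe]
    constructor
    · exact fun hx => ⟨hx.1, hx.2.2⟩
    · intro hx
      refine ⟨hx.1, ?_, hx.2⟩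
      rw [← mem_coe, hgr]
      exact Or.inl (hF₁ hx.2)
  have c2 : (((X ∩ (gr M).filter (fun x => x ∈ F₂)) : Finset α) : Set α) = (X : Set α) ∩ F₂ := by
    ext x
    simp only [coe_inter, coe_filter, Set.mem_inter_iff, Set.mem_setOf_eq, mem_coe]
    constructor
    · exact fun hx => ⟨hx.1, hx.2.2⟩
    · intro hx
      refine ⟨hx.1, ?_, hx.2⟩
      rw [← mem_coe, hgr]
      exact Or.inr (hF₂ hx.2)
  have c3 : (((X ∩ (gr M).filter (fun x => x ∉ F₁ ∧ x ∉ F₂)) : Finset α) : Set α) =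
      (X : Set α) ∩ ((E₁ ∪ E₂) \ (F₁ ∪ F₂)) := by
    ext x
    simp only [coe_inter, coe_filter, Set.mem_inter_iff, Set.mem_setOf_eq, mem_coe, Set.mem_sdiff,
      Set.mem_union, not_or]
    constructor
    · intro hx
      refine ⟨hx.1, ?_, hx.2.2⟩
      have := hXE hx.1
      exact this
    · intro hx
      refine ⟨hx.1, ?_, hx.2.2⟩
      rw [← mem_coe, hgr]
      exact hx.2.1
  rw [twoFlatModel_eRk hE₁ hE₂ F₁ F₂ s₁ s₂ h r hF₁ hF₂ (X : Set α)]
  congr 2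
  rw [← Set.ncard_coe_finset (X ∩ _), c1, ← Set.ncard_coe_finset (X ∩ _), c2,
    ← Set.ncard_coe_finset (X ∩ _), c3, ← ncard_free_parts hE₁ hE₂ F₁ F₂ hdisj hF₁ hF₂]
  omega

open Classical in
/-- **EVERY ROW `(q, u)`, `q < u < r`, OF (Π) ON THE TWO-FLAT MODEL, MODULO THE ARITHMETIC CORE** (TF) at
`(k₁, s₁, k₂, s₂, m, q, u)` with `k₁ = #F₁`, `k₂ = #F₂`, `m = #((E₁ ∪ E₂) ∖ (F₁ ∪ F₂))`. -/
theorem profileIneq_rows_twoFlatModel_of_arith (hF₁ : F₁ ⊆ E₁) (hF₂ : F₂ ⊆ E₂) {q u : ℕ} (hqu : q < u)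
    (hur : u < r)
    (hTF : ∑ i₁ ∈ range (F₁.ncard + 1), ∑ i₂ ∈ range (F₂.ncard + 1),
        F₁.ncard.choose i₁ * F₂.ncard.choose i₂ *
          (if min i₁ s₁ + min i₂ s₂ ≤ q ∧
              u ≤ min (F₁.ncard - i₁) s₁ + min (F₂.ncard - i₂) s₂ +
                (((E₁ ∪ E₂) \ (F₁ ∪ F₂)).ncard - (q - min i₁ s₁ - min i₂ s₂)) then
            ((E₁ ∪ E₂) \ (F₁ ∪ F₂)).ncard.choose (q - min i₁ s₁ - min i₂ s₂) *
              (min (F₁.ncard - i₁) s₁ + min (F₂.ncard - i₂) s₂ +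
                (((E₁ ∪ E₂) \ (F₁ ∪ F₂)).ncard - (q - min i₁ s₁ - min i₂ s₂))).choose (u - q)
          else 0) ≤
      u.choose q * ∑ j₁ ∈ range (F₁.ncard + 1), ∑ j₂ ∈ range (F₂.ncard + 1),
        F₁.ncard.choose j₁ * F₂.ncard.choose j₂ *
          (if min j₁ s₁ + min j₂ s₂ ≤ u then
            ((E₁ ∪ E₂) \ (F₁ ∪ F₂)).ncard.choose (u - min j₁ s₁ - min j₂ s₂) else 0)) :
    haveI := disjointSum_models_finite hE₁ hE₂ F₁ F₂ s₁ s₂ h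
    Profile.ProfileIneq (Matroid.truncate ((modelMatroid hE₁ F₁ s₁ (s₁ + (E₁ \ F₁).ncard)).disjointSum
      (modelMatroid hE₂ F₂ s₂ (s₂ + (E₂ \ F₂).ncard)) h) r) q u := by
  haveI := disjointSum_models_finite hE₁ hE₂ F₁ F₂ s₁ s₂ h
  have hdisj : Disjoint E₁ E₂ := by
    have := h
    rw [modelMatroid_E, modelMatroid_E] at this
    exact this
  set M := Matroid.truncate ((modelMatroid hE₁ F₁ s₁ (s₁ + (E₁ \ F₁).ncard)).disjointSum
    (modelMatroid hE₂ F₂ s₂ (s₂ + (E₂ \ F₂).ncard)) h) r with hM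
  have hgr : ((gr M : Finset α) : Set α) = E₁ ∪ E₂ := twoFlatModel_gr hE₁ hE₂ F₁ F₂ s₁ s₂ h r
  set E₁' := (gr M).filter (fun x => x ∈ F₁) with hE₁'
  set E₂' := (gr M).filter (fun x => x ∈ F₂) with hE₂'
  set E₃' := (gr M).filter (fun x => x ∉ F₁ ∧ x ∉ F₂) with hE₃'
  have hE : gr M = E₁' ∪ E₂' ∪ E₃' := by
    ext x
    simp only [hE₁', hE₂', hE₃', mem_union, mem_filter]
    constructor
    · intro hx
      by_cases h1 : x ∈ F₁
      · exact Or.inl (Or.inl ⟨hx, h1⟩)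
      by_cases h2 : x ∈ F₂
      · exact Or.inl (Or.inr ⟨hx, h2⟩)
      exact Or.inr ⟨hx, h1, h2⟩
    · rintro ((hx | hx) | hx) <;> exact hx.1
  have h12 : Disjoint E₁' E₂' := by
    rw [hE₁', hE₂', disjoint_filter]
    intro x _ hx1 hx2
    exact Set.disjoint_left.1 hdisj (hF₁ hx1) (hF₂ hx2)
  have h13 : Disjoint E₁' E₃' := by
    rw [hE₁', hE₃', disjoint_filter]
    intro x _ hx1 hx3
    exact hx3.1 hx1
  have h23 : Disjoint E₂' E₃' := by
    rw [hE₂', hE₃', disjoint_filter]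
    intro x _ hx2 hx3
    exact hx3.2 hx2
  have hk₁ : E₁'.card = F₁.ncard := by
    rw [← Set.ncard_coe_finset]
    congr 1
    ext x
    simp only [hE₁', coe_filter, Set.mem_setOf_eq]
    constructor
    · exact fun hx => hx.2
    · intro hx
      refine ⟨?_, hx⟩
      rw [← mem_coe, hgr]
      exact Or.inl (hF₁ hx)
  have hk₂ : E₂'.card = F₂.ncard := by
    rw [← Set.ncard_coe_finset]
    congr 1
    ext x
    simp only [hE₂', coe_filter, Set.mem_setOf_eq]
    constructor
    · exact fun hx => hx.2
    · intro hx
      refine ⟨?_, hx⟩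
      rw [← mem_coe, hgr]
      exact Or.inr (hF₂ hx)
  have hm : E₃'.card = ((E₁ ∪ E₂) \ (F₁ ∪ F₂)).ncard := by
    rw [← Set.ncard_coe_finset]
    congr 1
    ext x
    simp only [hE₃', coe_filter, Set.mem_setOf_eq, Set.mem_sdiff, Set.mem_union, not_or]
    have hx : x ∈ gr M ↔ x ∈ E₁ ∨ x ∈ E₂ := by
      rw [← mem_coe, hgr]
      exact Set.mem_union x E₁ E₂
    rw [hx]
  rw [← hk₁, ← hk₂, ← hm] at hTF
  exact profileIneq_rows_twoFlat_of_arith M E₁' E₂' E₃' s₁ s₂ r hE h12 h13 h23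
    (fun X hX => twoFlatModel_eRk_finset hE₁ hE₂ F₁ F₂ s₁ s₂ h r hF₁ hF₂ X hX) hqu hur hTF

/-- **C-025 AT EVERY `(p, q)` WITH `p ≤ r` ON THE TWO-FLAT MODEL `T_r(U_{s₁,F₁} ⊕ U_{s₂,F₂} ⊕ U_{m,m})`, MODULO THE
ARITHMETIC CORE** (TF) at the rows `q < u < p`. -/
theorem rls_twoFlatModel_of_arith (hF₁ : F₁ ⊆ E₁) (hF₂ : F₂ ⊆ E₂) (p q : ℕ) (hpr : p ≤ r)
    (hTF : ∀ u : ℕ, q < u → u < p →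
      ∑ i₁ ∈ range (F₁.ncard + 1), ∑ i₂ ∈ range (F₂.ncard + 1),
        F₁.ncard.choose i₁ * F₂.ncard.choose i₂ *
          (if min i₁ s₁ + min i₂ s₂ ≤ q ∧
              u ≤ min (F₁.ncard - i₁) s₁ + min (F₂.ncard - i₂) s₂ +
                (((E₁ ∪ E₂) \ (F₁ ∪ F₂)).ncard - (q - min i₁ s₁ - min i₂ s₂)) then
            ((E₁ ∪ E₂) \ (F₁ ∪ F₂)).ncard.choose (q - min i₁ s₁ - min i₂ s₂) *
              (min (F₁.ncard - i₁) s₁ + min (F₂.ncard - i₂) s₂ +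
                (((E₁ ∪ E₂) \ (F₁ ∪ F₂)).ncard - (q - min i₁ s₁ - min i₂ s₂))).choose (u - q)
          else 0) ≤
      u.choose q * ∑ j₁ ∈ range (F₁.ncard + 1), ∑ j₂ ∈ range (F₂.ncard + 1),
        F₁.ncard.choose j₁ * F₂.ncard.choose j₂ *
          (if min j₁ s₁ + min j₂ s₂ ≤ u then
            ((E₁ ∪ E₂) \ (F₁ ∪ F₂)).ncard.choose (u - min j₁ s₁ - min j₂ s₂) else 0)) :
    haveI := disjointSum_models_finite hE₁ hE₂ F₁ F₂ s₁ s₂ h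
    ThmN.RLS (Matroid.truncate ((modelMatroid hE₁ F₁ s₁ (s₁ + (E₁ \ F₁).ncard)).disjointSum
      (modelMatroid hE₂ F₂ s₂ (s₂ + (E₂ \ F₂).ncard)) h) r) p q := by
  haveI := disjointSum_models_finite hE₁ hE₂ F₁ F₂ s₁ s₂ h
  apply GirthRows.rls_of_profileIneq_rows
  intro u hu1 hu2
  exact profileIneq_rows_twoFlatModel_of_arith hE₁ hE₂ F₁ F₂ s₁ s₂ h r hF₁ hF₂ hu1 (by omega) (hTF u hu1 hu2)

end Model

end TwoFlat

end PercRepro
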